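import Summits.SmoothPoincare4.SmoothPoincare4.Theorems.EntropyRungNoncompactShrinkerGapCarrilloNiClauses
import HarnessLib

/-!
# Stub `stub_weightedIdentity` of line `Sketch` (crux `EntropyRung.ConicalGap`, stmt-SmoothPoincare4-16589)

Wang–Wang 2023 (arXiv:2308.06560, proof of Prop. 2.6, (2.9)–(2.10)), `n = 4`: on a complete connected
normalised gradient shrinking Ricci soliton `(M⁴, g, f)` (`Ric + Hess f = g/2`, `R + |∇f|² = f`, closed
`g`-balls compact), for every `τ > 0`,

  `∫ (f − 2τ) e^{-f/τ} dV = (1 − τ) ∫ R e^{-f/τ} dV`,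

GIVEN that the three weights `e^{-f/τ}`, `f e^{-f/τ}`, `R e^{-f/τ}` are integrable (the neighbouring stub
`stub_weightedIntegrability`; here a hypothesis). This is the vanishing of `∫_M Δ_g(e^{-f/τ}) dV` on the
complete manifold:

* pointwise, by the chain rule `Δ(ζ ∘ f) = ζ″(f) |∇f|² + ζ′(f) Δf` (`dalembertian_real_comp`) with
  `ζ(t) = e^{-t/τ}` and the traced soliton identities `Δf = n/2 − R`
  (`CarrilloNi2009_shrinkerLSI.scalarCurvature_add_dalembertian`), `|∇f|² = f − R`:
  `Δ(e^{-f/τ}) = τ⁻² e^{-f/τ} (f − τ n/2 + (τ − 1) R)` (`weightedIdentity_dalembertian_expNegDiv`);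
* globally, `∫ Δ(e^{-f/τ}) dV = 0` by the tree's cut-off Green identity along the proper exhaustion `f`
  (`CarrilloNi2009_shrinkerLSI.integral_dalembertian_eq_zero_of_proper`; properness of `f` and `R ≥ 0` are
  theorems of the tree, `NoncompactShrinkerGapCarrilloNiClauses.scalarCurvature_nonneg_and_isCompact_sublevel`),
  the integrability of `Δ(e^{-f/τ})` and of `g⁻¹(df, d e^{-f/τ}) = −τ⁻¹ e^{-f/τ} (f − R)` being that of
  the three weights.

Everything here is proved; no definition and no named fact is introduced.

## References

* Y. Wang, G. Wang (Wang–Wang 2023), arXiv:2308.06560, Prop. 2.6, (2.7)–(2.10).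
* [CarrilloNi2009] J. Carrillo, L. Ni, Comm. Anal. Geom. 17 (2009) 721–753, §2 (2.1)–(2.3), §4.
-/

noncomputable section

-- `Summit.SmoothPoincare4.SmoothPoincare4.…` (summit = problem) trips `dupNamespace` on every decl.
set_option linter.dupNamespace false

open scoped Manifold ContDiff ENNReal NNReal Topology
open MeasureTheory Set Filter
open Literature.Geometry.Lorentzian Literature.Geometry.Riemannian

namespace Summit.SmoothPoincare4.SmoothPoincare4.Theorems.ConicalGapSketch

/-! ## The weight `ζ(t) = e^{-t/τ}` on the real line -/

/-- `ζ(t) = e^{-t/τ}` has derivative `ζ′(t) = e^{-t/τ} · (−1/τ)`. -/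
theorem weightedIdentity_hasDerivAt_expNegDiv (τ t : ℝ) :
    HasDerivAt (fun s : ℝ ↦ Real.exp (-s / τ)) (Real.exp (-t / τ) * (-1 / τ)) t := by
  simpa using ((hasDerivAt_neg t).div_const τ).exp

/-- `ζ′ = e^{-·/τ} · (−1/τ)` as functions. -/
theorem weightedIdentity_deriv_expNegDiv (τ : ℝ) :
    deriv (fun s : ℝ ↦ Real.exp (-s / τ)) = fun t ↦ Real.exp (-t / τ) * (-1 / τ) :=
  funext fun t ↦ (weightedIdentity_hasDerivAt_expNegDiv τ t).deriv

/-- `ζ″(t) = e^{-t/τ} · (−1/τ) · (−1/τ)`. -/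
theorem weightedIdentity_deriv_deriv_expNegDiv (τ t : ℝ) :
    deriv (deriv fun s : ℝ ↦ Real.exp (-s / τ)) t = Real.exp (-t / τ) * (-1 / τ) * (-1 / τ) := by
  rw [weightedIdentity_deriv_expNegDiv]
  exact ((weightedIdentity_hasDerivAt_expNegDiv τ t).mul_const (-1 / τ)).deriv

/-! ## Pointwise identities on a normalised gradient shrinker (any dimension) -/

section Pointwise

variable {n : ℕ} {M : Type*} [TopologicalSpace M] [ChartedSpace (EuclideanSpace ℝ (Fin n)) M]
  [IsManifold (𝓡 n) ∞ M]
  {g : PseudoRiemannianMetric (𝓡 n) ∞ (EuclideanSpace ℝ (Fin n)) (TangentSpace (𝓡 n) : M → Type _)}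
  {f : M → ℝ}

/-- `d(e^{-f/τ}) = −τ⁻¹ e^{-f/τ} df` inside the inverse metric:
`g⁻¹(dρ, d(e^{-f/τ})) = e^{-f/τ} (−1/τ) g⁻¹(dρ, df)` (chain rule `mvfderiv_real_comp_apply`). -/
theorem weightedIdentity_innerDual_mvfderiv_expNegDiv (τ : ℝ) {ρ : M → ℝ} {x : M}
    (hfx : MDifferentiableAt (𝓡 n) 𝓘(ℝ, ℝ) f x) :
    g.innerDual x (mvfderiv (𝓡 n) ρ x).toLinearMap
        (mvfderiv (𝓡 n) (fun y ↦ Real.exp (-f y / τ)) x).toLinearMap =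
      Real.exp (-f x / τ) * (-1 / τ) *
        g.innerDual x (mvfderiv (𝓡 n) ρ x).toLinearMap (mvfderiv (𝓡 n) f x).toLinearMap := by
  have hd := weightedIdentity_hasDerivAt_expNegDiv τ (f x)
  have hlin : (mvfderiv (𝓡 n) (fun y ↦ Real.exp (-f y / τ)) x).toLinearMap =
      (Real.exp (-f x / τ) * (-1 / τ)) • (mvfderiv (𝓡 n) f x).toLinearMap := by
    ext v
    have := mvfderiv_real_comp_apply (I := 𝓡 n) hd hfx v
    simpa [Function.comp_def] using this
  rw [hlin]
  simp only [PseudoRiemannianMetric.innerDual, map_smul, smul_eq_mul]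

variable [g.HasLeviCivita]

/-- **`Δ(e^{-f/τ}) = τ⁻² e^{-f/τ} (f − R) − τ⁻¹ e^{-f/τ} (n/2 − R)`** on a gradient shrinker
`Ric + Hess f = g/2` normalised by `R + |∇f|² = f` (Wang–Wang 2023, the computation behind (2.9)):
the chain rule `Δ(ζ ∘ f) = ζ″(f)|∇f|² + ζ′(f) Δf` (`dalembertian_real_comp`) with `ζ = e^{-·/τ}`,
`|∇f|² = f − R` and `Δf = n/2 − R` (`scalarCurvature_add_dalembertian`). -/
theorem weightedIdentity_dalembertian_expNegDiv
    (hsol : ∀ (x : M) (X Y : TangentSpace (𝓡 n) x),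
      g.ricci x X Y + g.hessian f x X Y = (1 / 2 : ℝ) * g.val x X Y)
    (hnorm : ∀ x : M, g.scalarCurvature x + g.gradSq f x = f x)
    (hf : ContMDiff (𝓡 n) 𝓘(ℝ, ℝ) ∞ f) (τ : ℝ) (x : M) :
    g.dalembertian (fun y ↦ Real.exp (-f y / τ)) x =
      Real.exp (-f x / τ) * (-1 / τ) * (-1 / τ) * (f x - g.scalarCurvature x) +
        Real.exp (-f x / τ) * (-1 / τ) * (n / 2 - g.scalarCurvature x) := by
  have hfx : ContMDiffAt (𝓡 n) 𝓘(ℝ, ℝ) 2 f x := (hf.of_le ENat.LEInfty.out).contMDiffAt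
  have hζ : ContDiffAt ℝ 2 (fun t : ℝ ↦ Real.exp (-t / τ)) (f x) :=
    (Real.contDiff_exp.comp (contDiff_neg.div_const τ)).contDiffAt
  have hcomp := g.dalembertian_real_comp (ζ := fun t : ℝ ↦ Real.exp (-t / τ)) hfx hζ
  rw [show (fun y ↦ Real.exp (-f y / τ)) = (fun t : ℝ ↦ Real.exp (-t / τ)) ∘ f from rfl, hcomp,
    weightedIdentity_deriv_deriv_expNegDiv, (weightedIdentity_hasDerivAt_expNegDiv τ (f x)).deriv]
  have hgrad : g.innerDual x (mvfderiv (𝓡 n) f x).toLinearMap (mvfderiv (𝓡 n) f x).toLinearMap =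
      g.gradSq f x := rfl
  rw [hgrad]
  have h1 := CarrilloNi2009_shrinkerLSI.scalarCurvature_add_dalembertian hsol x
  have h2 := hnorm x
  have h3 : g.gradSq f x = f x - g.scalarCurvature x := by linarith
  have h4 : g.dalembertian f x = n / 2 - g.scalarCurvature x := by linarith
  rw [h3, h4]

end Pointwise

/-! ## The integrated identity (n = 4) -/

section Integrated

variable {M : Type} [TopologicalSpace M] [T2Space M] [SecondCountableTopology M]
  [ChartedSpace (EuclideanSpace ℝ (Fin 4)) M] [IsManifold (𝓡 4) ∞ M] [ConnectedSpace M]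
  [T3Space M] [MeasurableSpace M] [BorelSpace M]

/-- **Wang–Wang 2023, (2.9)–(2.10), `n = 4`, over `g.riemVolume`**: on a complete connected normalised
4-d gradient shrinker, if `e^{-f/τ}`, `f e^{-f/τ}`, `R e^{-f/τ}` are `dV`-integrable for a given `τ ≠ 0`,
then `∫ (f − 2τ) e^{-f/τ} dV = (1 − τ) ∫ R e^{-f/τ} dV`: the cut-off Green
identity `∫ Δ(e^{-f/τ}) dV = 0` (`integral_dalembertian_eq_zero_of_proper`, exhaustion `f`, proper by
`scalarCurvature_nonneg_and_isCompact_sublevel`) and the pointwise formula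
`weightedIdentity_dalembertian_expNegDiv`. -/
theorem weightedIdentity_riemVolume
    (g : PseudoRiemannianMetric (𝓡 4) ∞ (EuclideanSpace ℝ (Fin 4)) (TangentSpace (𝓡 4) : M → Type _))
    [g.HasLeviCivita] (f : M → ℝ) (hg : g.IsRiemannian)
    (hc : ∀ (x : M) (r : NNReal), IsCompact {y : M | g.edist hg x y ≤ r})
    (hf : ContMDiff (𝓡 4) 𝓘(ℝ, ℝ) ∞ f)
    (hsol : ∀ (x : M) (X Y : TangentSpace (𝓡 4) x),
      g.ricci x X Y + g.hessian f x X Y = (1 / 2 : ℝ) * g.val x X Y)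
    (hnorm : ∀ x : M, g.scalarCurvature x + g.gradSq f x = f x) {τ : ℝ} (hτ : τ ≠ 0)
    (hA : Integrable (fun x ↦ Real.exp (-f x / τ)) g.riemVolume)
    (hB : Integrable (fun x ↦ f x * Real.exp (-f x / τ)) g.riemVolume)
    (hC : Integrable (fun x ↦ g.scalarCurvature x * Real.exp (-f x / τ)) g.riemVolume) :
    ∫ x, (f x - 2 * τ) * Real.exp (-f x / τ) ∂g.riemVolume =
      (1 - τ) * ∫ x, g.scalarCurvature x * Real.exp (-f x / τ) ∂g.riemVolume := by
  obtain ⟨-, -, hprop⟩ :=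
    NoncompactShrinkerGapCarrilloNiClauses.scalarCurvature_nonneg_and_isCompact_sublevel g f hg hc hf
      hsol hnorm
  -- the weight is `C²`
  have hw : ContMDiff (𝓡 4) 𝓘(ℝ, ℝ) 2 (fun y ↦ Real.exp (-f y / τ)) :=
    ((Real.contDiff_exp.comp (contDiff_neg.div_const τ)).comp_contMDiff hf).of_le ENat.LEInfty.out
  -- pointwise Laplacian of the weight, `n = 4`
  have hpt : ∀ x, g.dalembertian (fun y ↦ Real.exp (-f y / τ)) x =
      (τ ^ 2)⁻¹ * ((f x - 2 * τ) * Real.exp (-f x / τ) -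
        (1 - τ) * (g.scalarCurvature x * Real.exp (-f x / τ))) := fun x ↦ by
    rw [weightedIdentity_dalembertian_expNegDiv hsol hnorm hf τ x]
    simp only [Nat.cast_ofNat]
    field_simp
    ring
  -- the integrand `(f − 2τ) e^{-f/τ}` is integrable
  have hD : Integrable (fun x ↦ (f x - 2 * τ) * Real.exp (-f x / τ)) g.riemVolume :=
    (hB.sub (hA.const_mul (2 * τ))).congr (Eventually.of_forall fun x ↦ by
      simp only [Pi.sub_apply]; ring)
  have hE : Integrable (fun x ↦ (f x - 2 * τ) * Real.exp (-f x / τ) -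
      (1 - τ) * (g.scalarCurvature x * Real.exp (-f x / τ))) g.riemVolume :=
    hD.sub (hC.const_mul (1 - τ))
  -- `Δ(e^{-f/τ})` is integrable
  have hΔ : Integrable (fun x ↦ g.dalembertian (fun y ↦ Real.exp (-f y / τ)) x) g.riemVolume :=
    (hE.const_mul ((τ ^ 2)⁻¹)).congr (Eventually.of_forall fun x ↦ (hpt x).symm)
  -- `g⁻¹(df, d e^{-f/τ}) = e^{-f/τ} (−1/τ) (f − R)` is integrable
  have hcross : Integrable (fun x ↦ g.innerDual x (mvfderiv (𝓡 4) f x).toLinearMap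
      (mvfderiv (𝓡 4) (fun y ↦ Real.exp (-f y / τ)) x).toLinearMap) g.riemVolume := by
    refine ((hB.sub hC).const_mul (-1 / τ)).congr (Eventually.of_forall fun x ↦ ?_)
    show -1 / τ * (f x * Real.exp (-f x / τ) - g.scalarCurvature x * Real.exp (-f x / τ)) =
      g.innerDual x (mvfderiv (𝓡 4) f x).toLinearMap
        (mvfderiv (𝓡 4) (fun y ↦ Real.exp (-f y / τ)) x).toLinearMap
    rw [weightedIdentity_innerDual_mvfderiv_expNegDiv τ (hf.mdifferentiableAt (by norm_num))]
    have hgrad : g.innerDual x (mvfderiv (𝓡 4) f x).toLinearMap (mvfderiv (𝓡 4) f x).toLinearMap =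
        g.gradSq f x := rfl
    rw [hgrad, show g.gradSq f x = f x - g.scalarCurvature x by linarith [hnorm x]]
    ring
  have h0 := CarrilloNi2009_shrinkerLSI.integral_dalembertian_eq_zero_of_proper hg hf hprop hw hΔ hcross
  simp_rw [hpt] at h0
  rw [integral_const_mul, mul_eq_zero, integral_sub hD (hC.const_mul _), integral_const_mul] at h0
  have hτ2 : (τ ^ 2)⁻¹ ≠ 0 := by positivity
  rcases h0 with h0 | h0
  · exact absurd h0 hτ2
  · linarith

end Integrated

/-! ## The registered stub -/

/-- **Stub `stub_weightedIdentity` of line `Sketch`** (Wang–Wang 2023, arXiv:2308.06560, (2.9)–(2.10),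
`n = 4`): on every complete connected normalised 4-d gradient shrinking Ricci soliton, GIVEN that
`e^{-f/τ}`, `f e^{-f/τ}`, `R e^{-f/τ}` are integrable for every `τ > 0`, one has for every `τ > 0`
`∫ (f − 2τ) e^{-f/τ} dV = (1 − τ) ∫ R e^{-f/τ} dV` (`dV` the Riemannian measure of
`g.toContMDiffRiemannianMetric hg`, to which `g.riemVolume` unfolds by `riemVolume_eq`):
`weightedIdentity_riemVolume`. -/
theorem stub_weightedIdentity : ∀ (M : Type) [TopologicalSpace M] [T2Space M] [SecondCountableTopology M] [ChartedSpace (EuclideanSpace ℝ (Fin 4)) M] [IsManifold (𝓡 4) ∞ M] [ConnectedSpace M] [T3Space M] [MeasurableSpace M] [BorelSpace M] (g : Literature.Geometry.Lorentzian.PseudoRiemannianMetric (𝓡 4) ∞ (EuclideanSpace ℝ (Fin 4)) (TangentSpace (𝓡 4) : M → Type _)) [g.HasLeviCivita] (f : M → ℝ) (hg : g.IsRiemannian), (∀ (x : M) (r : NNReal), IsCompact {y : M | g.edist hg x y ≤ r}) → ContMDiff (𝓡 4) 𝓘(ℝ, ℝ) ∞ f → (∀ (x : M) (X Y : TangentSpace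 (𝓡 4) x), g.ricci x X Y + g.hessian f x X Y = (1 / 2 : ℝ) * g.val x X Y) → (∀ x : M, g.scalarCurvature x + g.gradSq f x = f x) → (∀ τ : ℝ, 0 < τ → MeasureTheory.Integrable (fun x ↦ Real.exp (-f x / τ)) (Literature.Geometry.Lorentzian.riemannianMeasure (g.toContMDiffRiemannianMetric hg)) ∧ MeasureTheory.Integrable (fun x ↦ f x * Real.exp (-f x / τ)) (Literature.Geometry.Lorentzian.riemannianMeasure (g.toContMDiffRiemannianMetric hg)) ∧ MeasureTheory.Integrable (fun x ↦ g.scalarCurvature x * Real.exp (-f x / τ)) (Literature.Geometry.Lorentzian.riemannianMeasure (g.toContMDiffRiemannianMetric hg))) → ∀ τ : ℝ, 0 < τ → ∫ x, (f x - 2 * τ) * Real.exp (-f x / τ) ∂(Literature.Geometry.Lorentzian.riemannianMeasure (g.toContMDiffRiemannianMetric hg)) = (1 - τ) * ∫ x, g.scalarCurvature x * Real.exp (-f x / τ) ∂(Literature.Geometry.Lorentzian.riemannianMeasure (g.toContMDiffRiemannianMetric hg)) := by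
  intro M _ _ _ _ _ _ _ _ _ g _ f hg hc hf hsol hnorm hint τ hτ
  obtain ⟨hA, hB, hC⟩ := hint τ hτ
  rw [← PseudoRiemannianMetric.riemVolume_eq hg] at hA hB hC ⊢
  exact weightedIdentity_riemVolume g f hg hc hf hsol hnorm hτ.ne' hA hB hC

end Summit.SmoothPoincare4.SmoothPoincare4.Theorems.ConicalGapSketch

end
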